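import Summits.ResolutionOfSingularities.ResolutionOfSingularities.Theorems.FrobeniusLadderFInjectiveMacaulayficationPConePrimeCarrier
import Summits.ResolutionOfSingularities.ResolutionOfSingularities.Theorems.FrobeniusLadderFInjectiveMacaulayficationGradedDomainCoaction
import Mathlib.Algebra.MvPolynomial.Division
import Mathlib.RingTheory.Ideal.Quotient.Operations
import Mathlib.RingTheory.Localization.Away.Basic
import HarnessLib

/-!
# The P-cone ideal `(x²+y³−wU, Z²+wU³+w³) ⊆ k[x,y,w,Z,U]` is prime (crux `FInjectiveMacaulayfication`, line H4-gd, calibration G6ᵍ-P)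

Support file for crux stmt-ResolutionOfSingularities-15315 (`FrobeniusLadder.FInjectiveMacaulayfication`), line (H4-gd), calibration
G6ᵍ-P (CRUX-PLAN w45a v9 R9.3; seat res-L1-w45a-stub-2): the PRIMALITY input `(Ideal.span G).IsPrime` and the inputs `x̄_v ≠ 0` of
`GradedDomainConeFiModel.stub_gradedDomainConeFiModel` (p500711) for idea-2's codimension-2 specimen
`P = V(F₁, F₂) ⊂ 𝔸⁵`, `F₁ = x²+y³−wU`, `F₂ = Z²+wU³+w³`, variables `(x,y,w,Z,U) = (X 0,…,X 4)` of `S = MvPolynomial (Fin 5) k`,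
over EVERY field `k`.

PROOF. (1) `w` IS A NON-ZERODIVISOR mod `(F₁,F₂)` (`mem_of_X_mul_mem`): if `w h = αF₁ + βF₂`, kill `w` (`X 2 ↦ 0`): `α₀(x²+y³) + β₀Z² = 0`
in `S`, so `Z² ∣ α₀` (`Z` prime, `Z ∤ x²+y³`), `α₀ = Z²γ`, `β₀ = −(x²+y³)γ`; with `α = α₀ + wα'`, `β = β₀ + wβ'` and the SYZYGY
`Z²F₁ − (x²+y³)F₂ = −w·(U F₂ + (w²+U³) F₁)` one cancels `w`: `h = (α' − γ(w²+U³))F₁ + (β' − γU)F₂`.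
(2) THE `w`-CHART: `Φ : S/(F₁,F₂) → D = A[1/w̄]`, `A = k[Y,x,y,w]/(Y²+w⁵+(x²+y³)³)` a domain (`…PConePrimeCarrier`),
`x,y,w ↦ x,y,w`, `Z ↦ Y/w`, `U ↦ (x²+y³)/w` (kills `F₁, F₂`), and `Ψ : D → (S/(F₁,F₂))[1/w̄]`, `Y ↦ Zw` (kills `G`: `(Zw)² + w⁵ + (x²+y³)³
= w²F₂` mod `F₁`), with `Ψ ∘ Φ =` the localisation map, injective by (1); so `Φ` is injective into a domain, `S/(F₁,F₂)` is a domain,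
`(F₁,F₂)` is prime (`pCone_isPrime`), and the variables are non-zero in the quotient (`pCone_X_ne_zero`: their `Φ`-images are non-zero).
[OURS · L1 W4.5a] AI-written; AI review is weaker than expert review. No statement of Hironaka2017 is used; no external fact.
No definitions, no named facts. [folklore]
-/

set_option linter.dupNamespace false

noncomputable section

open MvPolynomial

namespace Summit.ResolutionOfSingularities.ResolutionOfSingularities.Theorems.FInjectiveMacaulayfication.PConePrime

open Summit.ResolutionOfSingularities.ResolutionOfSingularities.Theorems.FInjectiveMacaulayfication

variable {k : Type} [Field k]

/-! ## (1) `w = X 2` is a non-zerodivisor modulo `(F₁, F₂)` -/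

/-- Killing the variable `X 2`: `X 2 ∣ p − p(X 2 ↦ 0)`. [folklore] -/
theorem X_dvd_sub_kill (p : MvPolynomial (Fin 5) k) :
    (X 2 : MvPolynomial (Fin 5) k) ∣
      p - MvPolynomial.aeval (![X 0, X 1, 0, X 3, X 4] : Fin 5 → MvPolynomial (Fin 5) k) p := by
  induction p using MvPolynomial.induction_on with
  | C a => rw [MvPolynomial.algHom_C, MvPolynomial.algebraMap_eq, sub_self]; exact dvd_zero _
  | add p q hp hq => rw [map_add, add_sub_add_comm]; exact dvd_add hp hq
  | mul_X p j hp =>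
    rw [map_mul, MvPolynomial.aeval_X]
    rcases (by decide : ∀ j : Fin 5, j = 0 ∨ j = 1 ∨ j = 2 ∨ j = 3 ∨ j = 4) j with rfl | rfl | rfl | rfl | rfl
    · rw [show (![X 0, X 1, 0, X 3, X 4] : Fin 5 → MvPolynomial (Fin 5) k) 0 = X 0 from rfl, ← sub_mul]
      exact dvd_mul_of_dvd_left hp _
    · rw [show (![X 0, X 1, 0, X 3, X 4] : Fin 5 → MvPolynomial (Fin 5) k) 1 = X 1 from rfl, ← sub_mul]
      exact dvd_mul_of_dvd_left hp _
    · rw [show (![X 0, X 1, 0, X 3, X 4] : Fin 5 → MvPolynomial (Fin 5) k) 2 = 0 from rfl, mul_zero, sub_zero]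
      exact dvd_mul_left _ _
    · rw [show (![X 0, X 1, 0, X 3, X 4] : Fin 5 → MvPolynomial (Fin 5) k) 3 = X 3 from rfl, ← sub_mul]
      exact dvd_mul_of_dvd_left hp _
    · rw [show (![X 0, X 1, 0, X 3, X 4] : Fin 5 → MvPolynomial (Fin 5) k) 4 = X 4 from rfl, ← sub_mul]
      exact dvd_mul_of_dvd_left hp _

/-- `Z = X 3` does not divide `x² + y³`. [folklore] -/
theorem X_three_not_dvd_t : ¬ (X 3 : MvPolynomial (Fin 5) k) ∣ X 0 ^ 2 + X 1 ^ 3 := by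
  rintro ⟨q, hq⟩
  have h := congrArg (MvPolynomial.aeval (R := k) (![X 0, X 1, X 2, 0, X 4] : Fin 5 → MvPolynomial (Fin 5) k)) hq
  rw [map_add, map_pow, map_pow, map_mul, MvPolynomial.aeval_X, MvPolynomial.aeval_X, MvPolynomial.aeval_X,
    show (![X 0, X 1, X 2, 0, X 4] : Fin 5 → MvPolynomial (Fin 5) k) 0 = X 0 from rfl,
    show (![X 0, X 1, X 2, 0, X 4] : Fin 5 → MvPolynomial (Fin 5) k) 1 = X 1 from rfl,
    show (![X 0, X 1, X 2, 0, X 4] : Fin 5 → MvPolynomial (Fin 5) k) 3 = 0 from rfl, zero_mul] at h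
  have h' := congrArg (MvPolynomial.coeff (Finsupp.single 0 2)) h
  rw [MvPolynomial.coeff_add, MvPolynomial.X_pow_eq_monomial, MvPolynomial.X_pow_eq_monomial, MvPolynomial.coeff_monomial,
    MvPolynomial.coeff_monomial, if_pos rfl, if_neg, MvPolynomial.coeff_zero] at h'
  · norm_num at h'
  · intro hh
    have := congrArg (fun f => f 0) hh
    simp at this

/-- **`w` is a non-zerodivisor modulo `(F₁,F₂)`**: `w·h ∈ (F₁,F₂) ⇒ h ∈ (F₁,F₂)` (kill `w`, `Z² ∣ α₀`, the syzygy
`Z²F₁ − (x²+y³)F₂ = −w(UF₂ + (w²+U³)F₁)`, cancel `w`). [folklore] -/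
theorem mem_of_X_mul_mem (F₁ F₂ : MvPolynomial (Fin 5) k) (h₁ : F₁ = X 0 ^ 2 + X 1 ^ 3 - X 2 * X 4)
    (h₂ : F₂ = X 3 ^ 2 + X 2 * X 4 ^ 3 + X 2 ^ 3) (h : MvPolynomial (Fin 5) k)
    (hh : X 2 * h ∈ Ideal.span {F₁, F₂}) : h ∈ Ideal.span {F₁, F₂} := by
  obtain ⟨α, β, hαβ⟩ := Ideal.mem_span_pair.mp hh
  -- kill `w`
  have hk₁ : MvPolynomial.aeval (![X 0, X 1, 0, X 3, X 4] : Fin 5 → MvPolynomial (Fin 5) k) F₁ = X 0 ^ 2 + X 1 ^ 3 := by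
    rw [h₁]; simp [MvPolynomial.aeval_X, Matrix.cons_val]
  have hk₂ : MvPolynomial.aeval (![X 0, X 1, 0, X 3, X 4] : Fin 5 → MvPolynomial (Fin 5) k) F₂ = X 3 ^ 2 := by
    rw [h₂]; simp [MvPolynomial.aeval_X, Matrix.cons_val]
  have hk := congrArg (MvPolynomial.aeval (R := k) (![X 0, X 1, 0, X 3, X 4] : Fin 5 → MvPolynomial (Fin 5) k)) hαβ
  rw [map_add, map_mul, map_mul, hk₁, hk₂, map_mul, MvPolynomial.aeval_X,
    show (![X 0, X 1, 0, X 3, X 4] : Fin 5 → MvPolynomial (Fin 5) k) 2 = 0 from rfl, zero_mul] at hk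
  set α₀ := MvPolynomial.aeval (![X 0, X 1, 0, X 3, X 4] : Fin 5 → MvPolynomial (Fin 5) k) α with hα₀
  set β₀ := MvPolynomial.aeval (![X 0, X 1, 0, X 3, X 4] : Fin 5 → MvPolynomial (Fin 5) k) β with hβ₀
  -- `Z² ∣ α₀`
  have hZ : Prime (X 3 : MvPolynomial (Fin 5) k) := MvPolynomial.X_prime
  have hdvd : (X 3 : MvPolynomial (Fin 5) k) ∣ α₀ * (X 0 ^ 2 + X 1 ^ 3) :=
    ⟨-β₀ * X 3, by linear_combination hk⟩
  obtain ⟨α₁, hα₁⟩ := (hZ.dvd_or_dvd hdvd).resolve_right X_three_not_dvd_t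
  have hdvd' : (X 3 : MvPolynomial (Fin 5) k) ∣ α₁ * (X 0 ^ 2 + X 1 ^ 3) := by
    refine ⟨-β₀, mul_left_cancel₀ (MvPolynomial.X_ne_zero (3 : Fin 5)) ?_⟩
    linear_combination hk - (X 0 ^ 2 + X 1 ^ 3) * hα₁
  obtain ⟨γ, hγ⟩ := (hZ.dvd_or_dvd hdvd').resolve_right X_three_not_dvd_t
  have hβ : β₀ = -(X 0 ^ 2 + X 1 ^ 3) * γ := by
    have h3 : (X 3 : MvPolynomial (Fin 5) k) ^ 2 ≠ 0 := pow_ne_zero 2 (MvPolynomial.X_ne_zero 3)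
    refine mul_left_cancel₀ h3 ?_
    linear_combination hk - (X 0 ^ 2 + X 1 ^ 3) * hα₁ - (X 0 ^ 2 + X 1 ^ 3) * X 3 * hγ
  -- `α = α₀ + wα'`, `β = β₀ + wβ'`
  obtain ⟨α', hα'⟩ := X_dvd_sub_kill α
  obtain ⟨β', hβ'⟩ := X_dvd_sub_kill β
  rw [← hα₀] at hα'
  rw [← hβ₀] at hβ'
  -- cancel `w`
  have key : X 2 * h = X 2 * ((α' - γ * (X 2 ^ 2 + X 4 ^ 3)) * F₁ + (β' - γ * X 4) * F₂) := by
    rw [← hαβ, h₁, h₂]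
    linear_combination (X 0 ^ 2 + X 1 ^ 3 - X 2 * X 4) * hα' + (X 3 ^ 2 + X 2 * X 4 ^ 3 + X 2 ^ 3) * hβ' +
      (X 0 ^ 2 + X 1 ^ 3 - X 2 * X 4) * hα₁ + (X 0 ^ 2 + X 1 ^ 3 - X 2 * X 4) * X 3 * hγ +
      (X 3 ^ 2 + X 2 * X 4 ^ 3 + X 2 ^ 3) * hβ
  rw [mul_left_cancel₀ (MvPolynomial.X_ne_zero (2 : Fin 5)) key]
  exact Ideal.mem_span_pair.mpr ⟨_, _, rfl⟩

/-- `w̄ = X̄ 2` is a non-zerodivisor of `S/(F₁,F₂)`. [folklore] -/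
theorem mk_X_two_mem_nonZeroDivisors (F₁ F₂ : MvPolynomial (Fin 5) k) (h₁ : F₁ = X 0 ^ 2 + X 1 ^ 3 - X 2 * X 4)
    (h₂ : F₂ = X 3 ^ 2 + X 2 * X 4 ^ 3 + X 2 ^ 3) :
    Ideal.Quotient.mk (Ideal.span {F₁, F₂}) (X 2) ∈ nonZeroDivisors (MvPolynomial (Fin 5) k ⧸ Ideal.span {F₁, F₂}) := by
  refine mem_nonZeroDivisors_iff_right.mpr fun z hz => ?_
  obtain ⟨h, rfl⟩ := Ideal.Quotient.mk_surjective z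
  rw [← map_mul, Ideal.Quotient.eq_zero_iff_mem, mul_comm] at hz
  exact Ideal.Quotient.eq_zero_iff_mem.mpr (mem_of_X_mul_mem F₁ F₂ h₁ h₂ h hz)

/-! ## (2) The `w`-chart `Φ : S/(F₁,F₂) → A[1/w̄]` and its retraction `Ψ` -/

set_option maxHeartbeats 400000 in
/-- **The `w`-chart map** `Φ : S/(F₁,F₂) → D = A[1/w̄]`, `A = k[Y,x,y,w]/(G)`, `G = Y²+w⁵+(x²+y³)³`: `x,y,w ↦ x,y,w`,
`Z ↦ Y·w⁻¹`, `U ↦ (x²+y³)·w⁻¹` (it kills `F₁` and `F₂`: `Y² = −w⁵ − (x²+y³)³` and `w·w⁻¹ = 1`). [folklore] -/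
theorem exists_phi (F₁ F₂ : MvPolynomial (Fin 5) k) (h₁ : F₁ = X 0 ^ 2 + X 1 ^ 3 - X 2 * X 4)
    (h₂ : F₂ = X 3 ^ 2 + X 2 * X 4 ^ 3 + X 2 ^ 3) (G : MvPolynomial (Fin 4) k)
    (hG : G = X 0 ^ 2 + X 3 ^ 5 + (X 1 ^ 2 + X 2 ^ 3) ^ 3) :
    ∃ Φ : (MvPolynomial (Fin 5) k ⧸ Ideal.span {F₁, F₂}) →ₐ[k] (Localization.Away (Ideal.Quotient.mk (Ideal.span {G}) (X 3))),
      Φ (Ideal.Quotient.mk _ (X 0)) = algebraMap (MvPolynomial (Fin 4) k ⧸ Ideal.span {G}) (Localization.Away (Ideal.Quotient.mk (Ideal.span {G}) (X 3))) (Ideal.Quotient.mk _ (X 1)) ∧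
      Φ (Ideal.Quotient.mk _ (X 1)) = algebraMap (MvPolynomial (Fin 4) k ⧸ Ideal.span {G}) (Localization.Away (Ideal.Quotient.mk (Ideal.span {G}) (X 3))) (Ideal.Quotient.mk _ (X 2)) ∧
      Φ (Ideal.Quotient.mk _ (X 2)) = algebraMap (MvPolynomial (Fin 4) k ⧸ Ideal.span {G}) (Localization.Away (Ideal.Quotient.mk (Ideal.span {G}) (X 3))) (Ideal.Quotient.mk _ (X 3)) ∧
      Φ (Ideal.Quotient.mk _ (X 3)) = algebraMap (MvPolynomial (Fin 4) k ⧸ Ideal.span {G}) (Localization.Away (Ideal.Quotient.mk (Ideal.span {G}) (X 3))) (Ideal.Quotient.mk _ (X 0)) *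
        IsLocalization.Away.invSelf (Ideal.Quotient.mk (Ideal.span {G}) (X 3)) ∧
      Φ (Ideal.Quotient.mk _ (X 4)) = algebraMap (MvPolynomial (Fin 4) k ⧸ Ideal.span {G}) (Localization.Away (Ideal.Quotient.mk (Ideal.span {G}) (X 3))) (Ideal.Quotient.mk _ (X 1 ^ 2 + X 2 ^ 3)) *
        IsLocalization.Away.invSelf (Ideal.Quotient.mk (Ideal.span {G}) (X 3)) := by
  obtain ⟨aD, haD⟩ : ∃ aD : MvPolynomial (Fin 4) k →+* (Localization.Away (Ideal.Quotient.mk (Ideal.span {G}) (X 3))),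
      aD = (algebraMap (MvPolynomial (Fin 4) k ⧸ Ideal.span {G}) _).comp (Ideal.Quotient.mk _) := ⟨_, rfl⟩
  obtain ⟨inv, hinv⟩ : ∃ inv : (Localization.Away (Ideal.Quotient.mk (Ideal.span {G}) (X 3))), inv = IsLocalization.Away.invSelf (Ideal.Quotient.mk (Ideal.span {G}) (X 3)) :=
    ⟨_, rfl⟩
  have haDq : ∀ q, aD q = algebraMap _ _ (Ideal.Quotient.mk (Ideal.span {G}) q) := fun q => by rw [haD]; rfl
  have hwinv : aD (X 3) * inv = 1 := by rw [haDq, hinv]; exact IsLocalization.Away.mul_invSelf _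
  have hGD : aD (X 0) ^ 2 + aD (X 3) ^ 5 + (aD (X 1) ^ 2 + aD (X 2) ^ 3) ^ 3 = 0 := by
    have h0 : aD G = 0 := by
      rw [haDq, Ideal.Quotient.eq_zero_iff_mem.mpr (Ideal.subset_span (Set.mem_singleton _)), map_zero]
    have h0' : aD G = aD (X 0 ^ 2 + X 3 ^ 5 + (X 1 ^ 2 + X 2 ^ 3) ^ 3) := congrArg aD hG
    rw [h0] at h0'
    simpa only [map_add, map_pow, map_mul] using h0'.symm
  obtain ⟨vD, hvD⟩ : ∃ vD : Fin 5 → (Localization.Away (Ideal.Quotient.mk (Ideal.span {G}) (X 3))),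
      vD = ![aD (X 1), aD (X 2), aD (X 3), aD (X 0) * inv, aD (X 1 ^ 2 + X 2 ^ 3) * inv] := ⟨_, rfl⟩
  have hv0 : vD 0 = aD (X 1) := by rw [hvD]; rfl
  have hv1 : vD 1 = aD (X 2) := by rw [hvD]; rfl
  have hv2 : vD 2 = aD (X 3) := by rw [hvD]; rfl
  have hv3 : vD 3 = aD (X 0) * inv := by rw [hvD]; rfl
  have hv4 : vD 4 = aD (X 1 ^ 2 + X 2 ^ 3) * inv := by rw [hvD]; rfl
  have hφ₁ : MvPolynomial.aeval vD F₁ = 0 := by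
    rw [h₁]
    simp only [map_add, map_sub, map_pow, map_mul, MvPolynomial.aeval_X, hv0, hv1, hv2, hv4]
    linear_combination (-(aD (X 1) ^ 2 + aD (X 2) ^ 3)) * hwinv
  have hφ₂ : MvPolynomial.aeval vD F₂ = 0 := by
    rw [h₂]
    simp only [map_add, map_pow, map_mul, MvPolynomial.aeval_X, hv2, hv3, hv4]
    linear_combination inv ^ 2 * hGD +
      ((aD (X 1) ^ 2 + aD (X 2) ^ 3) ^ 3 * inv ^ 2 - aD (X 3) ^ 3 * (aD (X 3) * inv + 1)) * hwinv
  have hφI : ∀ g ∈ Ideal.span {F₁, F₂}, MvPolynomial.aeval vD g = 0 := by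
    intro g hg
    rw [← RingHom.mem_ker]
    refine (Ideal.span_le (I := RingHom.ker _)).mpr ?_ hg
    rintro f (rfl | rfl)
    · exact hφ₁
    · exact hφ₂
  refine ⟨Ideal.Quotient.liftₐ _ (MvPolynomial.aeval vD) hφI, ?_, ?_, ?_, ?_, ?_⟩ <;>
    rw [Ideal.Quotient.liftₐ_apply, Ideal.Quotient.lift_mk, AlgHom.coe_toRingHom, MvPolynomial.aeval_X]
  · rw [hv0, haDq]
  · rw [hv1, haDq]
  · rw [hv2, haDq]
  · rw [hv3, haDq, hinv]
  · rw [hv4, haDq, hinv]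

set_option maxHeartbeats 400000 in
-- budget: the relation `G ↦ w²·F₂ (mod F₁)` is checked by `linear_combination` in a localisation of a quotient (≈ 1.5× default)
/-- **The retraction** `Ψ : D = A[1/w̄] → (S/(F₁,F₂))[1/w̄]`, `Y ↦ Zw`, `x,y,w ↦ x,y,w` (it kills `G`:
`(Zw)² + w⁵ + (x²+y³)³ = w²·F₂` modulo `F₁`; `w̄` is a unit in the target). [folklore] -/
theorem exists_psi (F₁ F₂ : MvPolynomial (Fin 5) k) (h₁ : F₁ = X 0 ^ 2 + X 1 ^ 3 - X 2 * X 4)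
    (h₂ : F₂ = X 3 ^ 2 + X 2 * X 4 ^ 3 + X 2 ^ 3) (G : MvPolynomial (Fin 4) k)
    (hG : G = X 0 ^ 2 + X 3 ^ 5 + (X 1 ^ 2 + X 2 ^ 3) ^ 3) :
    ∃ Ψ : (Localization.Away (Ideal.Quotient.mk (Ideal.span {G}) (X 3))) →+* (Localization.Away (Ideal.Quotient.mk (Ideal.span {F₁, F₂}) (X 2))),
      (∀ r : k, Ψ (algebraMap k (Localization.Away (Ideal.Quotient.mk (Ideal.span {G}) (X 3))) r) = algebraMap k (Localization.Away (Ideal.Quotient.mk (Ideal.span {F₁, F₂}) (X 2))) r) ∧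
      Ψ (algebraMap (MvPolynomial (Fin 4) k ⧸ Ideal.span {G}) (Localization.Away (Ideal.Quotient.mk (Ideal.span {G}) (X 3))) (Ideal.Quotient.mk _ (X 0))) =
        algebraMap (MvPolynomial (Fin 5) k ⧸ Ideal.span {F₁, F₂}) (Localization.Away (Ideal.Quotient.mk (Ideal.span {F₁, F₂}) (X 2))) (Ideal.Quotient.mk _ (X 3)) * algebraMap (MvPolynomial (Fin 5) k ⧸ Ideal.span {F₁, F₂}) (Localization.Away (Ideal.Quotient.mk (Ideal.span {F₁, F₂}) (X 2))) (Ideal.Quotient.mk _ (X 2)) ∧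
      Ψ (algebraMap (MvPolynomial (Fin 4) k ⧸ Ideal.span {G}) (Localization.Away (Ideal.Quotient.mk (Ideal.span {G}) (X 3))) (Ideal.Quotient.mk _ (X 1))) = algebraMap (MvPolynomial (Fin 5) k ⧸ Ideal.span {F₁, F₂}) (Localization.Away (Ideal.Quotient.mk (Ideal.span {F₁, F₂}) (X 2))) (Ideal.Quotient.mk _ (X 0)) ∧
      Ψ (algebraMap (MvPolynomial (Fin 4) k ⧸ Ideal.span {G}) (Localization.Away (Ideal.Quotient.mk (Ideal.span {G}) (X 3))) (Ideal.Quotient.mk _ (X 2))) = algebraMap (MvPolynomial (Fin 5) k ⧸ Ideal.span {F₁, F₂}) (Localization.Away (Ideal.Quotient.mk (Ideal.span {F₁, F₂}) (X 2))) (Ideal.Quotient.mk _ (X 1)) ∧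
      Ψ (algebraMap (MvPolynomial (Fin 4) k ⧸ Ideal.span {G}) (Localization.Away (Ideal.Quotient.mk (Ideal.span {G}) (X 3))) (Ideal.Quotient.mk _ (X 3))) = algebraMap (MvPolynomial (Fin 5) k ⧸ Ideal.span {F₁, F₂}) (Localization.Away (Ideal.Quotient.mk (Ideal.span {F₁, F₂}) (X 2))) (Ideal.Quotient.mk _ (X 2)) := by
  obtain ⟨bB, hbB⟩ : ∃ bB : MvPolynomial (Fin 5) k →+* (Localization.Away (Ideal.Quotient.mk (Ideal.span {F₁, F₂}) (X 2))),
      bB = (algebraMap (MvPolynomial (Fin 5) k ⧸ Ideal.span {F₁, F₂}) _).comp (Ideal.Quotient.mk _) := ⟨_, rfl⟩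
  have hbBq : ∀ q, bB q = algebraMap _ _ (Ideal.Quotient.mk (Ideal.span {F₁, F₂}) q) := fun q => by rw [hbB]; rfl
  have hF₁B : bB (X 0) ^ 2 + bB (X 1) ^ 3 - bB (X 2) * bB (X 4) = 0 := by
    have h0 : bB F₁ = 0 := by
      rw [hbBq, Ideal.Quotient.eq_zero_iff_mem.mpr (Ideal.subset_span (Set.mem_insert _ _)), map_zero]
    have h0' : bB F₁ = bB (X 0 ^ 2 + X 1 ^ 3 - X 2 * X 4) := congrArg bB h₁
    rw [h0] at h0'
    simpa only [map_add, map_sub, map_pow, map_mul] using h0'.symm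
  have hF₂B : bB (X 3) ^ 2 + bB (X 2) * bB (X 4) ^ 3 + bB (X 2) ^ 3 = 0 := by
    have h0 : bB F₂ = 0 := by
      rw [hbBq, Ideal.Quotient.eq_zero_iff_mem.mpr (Ideal.subset_span (Set.mem_insert_of_mem _ (Set.mem_singleton _))),
        map_zero]
    have h0' : bB F₂ = bB (X 3 ^ 2 + X 2 * X 4 ^ 3 + X 2 ^ 3) := congrArg bB h₂
    rw [h0] at h0'
    simpa only [map_add, map_pow, map_mul] using h0'.symm
  obtain ⟨vB, hvB⟩ : ∃ vB : Fin 4 → (Localization.Away (Ideal.Quotient.mk (Ideal.span {F₁, F₂}) (X 2))), vB = ![bB (X 3) * bB (X 2), bB (X 0), bB (X 1), bB (X 2)] := ⟨_, rfl⟩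
  have hu0 : vB 0 = bB (X 3) * bB (X 2) := by rw [hvB]; rfl
  have hu1 : vB 1 = bB (X 0) := by rw [hvB]; rfl
  have hu2 : vB 2 = bB (X 1) := by rw [hvB]; rfl
  have hu3 : vB 3 = bB (X 2) := by rw [hvB]; rfl
  have hψG : MvPolynomial.aeval vB G = 0 := by
    rw [hG]
    simp only [map_add, map_pow, MvPolynomial.aeval_X, hu0, hu1, hu2, hu3]
    linear_combination bB (X 2) ^ 2 * hF₂B +
      ((bB (X 0) ^ 2 + bB (X 1) ^ 3) ^ 2 + (bB (X 0) ^ 2 + bB (X 1) ^ 3) * (bB (X 2) * bB (X 4)) +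
        (bB (X 2) * bB (X 4)) ^ 2) * hF₁B
  have hψJ : ∀ g ∈ Ideal.span {G}, MvPolynomial.aeval vB g = 0 := by
    intro g hg
    rw [← RingHom.mem_ker]
    refine (Ideal.span_le (I := RingHom.ker _)).mpr ?_ hg
    rintro f rfl
    exact hψG
  obtain ⟨ψ, hψ⟩ : ∃ ψ : (MvPolynomial (Fin 4) k ⧸ Ideal.span {G}) →ₐ[k] (Localization.Away (Ideal.Quotient.mk (Ideal.span {F₁, F₂}) (X 2))), ψ = Ideal.Quotient.liftₐ _ (MvPolynomial.aeval vB) hψJ := ⟨_, rfl⟩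
  have hψmk : ∀ q : MvPolynomial (Fin 4) k, ψ (Ideal.Quotient.mk _ q) = MvPolynomial.aeval vB q := fun q => by
    rw [hψ, Ideal.Quotient.liftₐ_apply, Ideal.Quotient.lift_mk]
    rfl
  have hunit : IsUnit (ψ.toRingHom (Ideal.Quotient.mk (Ideal.span {G}) (X 3))) := by
    rw [AlgHom.toRingHom_eq_coe, RingHom.coe_coe, hψmk, MvPolynomial.aeval_X, hu3, hbBq]
    exact IsLocalization.Away.algebraMap_isUnit _
  refine ⟨IsLocalization.Away.lift _ hunit, fun r => ?_, ?_, ?_, ?_, ?_⟩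
  · rw [← GradedDomainCoaction.algebraMap_mk_C (Ideal.span {G}) _ r, IsLocalization.Away.lift_eq, AlgHom.toRingHom_eq_coe,
      RingHom.coe_coe, hψmk, MvPolynomial.algHom_C]
  all_goals rw [IsLocalization.Away.lift_eq, AlgHom.toRingHom_eq_coe, RingHom.coe_coe, hψmk, MvPolynomial.aeval_X]
  · rw [hu0, hbBq, hbBq]
  · rw [hu1, hbBq]
  · rw [hu2, hbBq]
  · rw [hu3, hbBq]

set_option maxHeartbeats 400000 in
-- budget: five generator identities and an induction over `k[x,y,w,Z,U]` in a localisation of a quotient (≈ 1.5× default)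
/-- **THE `w`-CHART IS AN EMBEDDING.** `Φ : S/(F₁,F₂) → D = A[1/w̄]` (`exists_phi`) is INJECTIVE: its composite with the
retraction `Ψ` (`exists_psi`) is the localisation map `S/(F₁,F₂) → (S/(F₁,F₂))[1/w̄]` (checked pointwise on polynomials;
composing the ring maps themselves would make Lean unify two instance paths on the localisation), which is injective because
`w̄` is a non-zerodivisor (`mk_X_two_mem_nonZeroDivisors`); also `w⁻¹ ≠ 0` in `D`. [folklore] -/
theorem exists_wChart (F₁ F₂ : MvPolynomial (Fin 5) k) (h₁ : F₁ = X 0 ^ 2 + X 1 ^ 3 - X 2 * X 4)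
    (h₂ : F₂ = X 3 ^ 2 + X 2 * X 4 ^ 3 + X 2 ^ 3) (G : MvPolynomial (Fin 4) k)
    (hG : G = X 0 ^ 2 + X 3 ^ 5 + (X 1 ^ 2 + X 2 ^ 3) ^ 3) :
    ∃ Φ : (MvPolynomial (Fin 5) k ⧸ Ideal.span {F₁, F₂}) →ₐ[k] (Localization.Away (Ideal.Quotient.mk (Ideal.span {G}) (X 3))),
      Function.Injective Φ ∧
      IsLocalization.Away.invSelf (S := (Localization.Away (Ideal.Quotient.mk (Ideal.span {G}) (X 3)))) (Ideal.Quotient.mk (Ideal.span {G}) (X 3)) ≠ 0 ∧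
      Φ (Ideal.Quotient.mk _ (X 0)) = algebraMap (MvPolynomial (Fin 4) k ⧸ Ideal.span {G}) (Localization.Away (Ideal.Quotient.mk (Ideal.span {G}) (X 3))) (Ideal.Quotient.mk _ (X 1)) ∧
      Φ (Ideal.Quotient.mk _ (X 1)) = algebraMap (MvPolynomial (Fin 4) k ⧸ Ideal.span {G}) (Localization.Away (Ideal.Quotient.mk (Ideal.span {G}) (X 3))) (Ideal.Quotient.mk _ (X 2)) ∧
      Φ (Ideal.Quotient.mk _ (X 2)) = algebraMap (MvPolynomial (Fin 4) k ⧸ Ideal.span {G}) (Localization.Away (Ideal.Quotient.mk (Ideal.span {G}) (X 3))) (Ideal.Quotient.mk _ (X 3)) ∧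
      Φ (Ideal.Quotient.mk _ (X 3)) = algebraMap (MvPolynomial (Fin 4) k ⧸ Ideal.span {G}) (Localization.Away (Ideal.Quotient.mk (Ideal.span {G}) (X 3))) (Ideal.Quotient.mk _ (X 0)) *
        IsLocalization.Away.invSelf (Ideal.Quotient.mk (Ideal.span {G}) (X 3)) ∧
      Φ (Ideal.Quotient.mk _ (X 4)) = algebraMap (MvPolynomial (Fin 4) k ⧸ Ideal.span {G}) (Localization.Away (Ideal.Quotient.mk (Ideal.span {G}) (X 3))) (Ideal.Quotient.mk _ (X 1 ^ 2 + X 2 ^ 3)) *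
        IsLocalization.Away.invSelf (Ideal.Quotient.mk (Ideal.span {G}) (X 3)) := by
  have hnzd := mk_X_two_mem_nonZeroDivisors F₁ F₂ h₁ h₂
  haveI := PConePrimeCarrier.isDomain_away G hG
  obtain ⟨Φ, h0, h1, h2, h3, h4⟩ := exists_phi F₁ F₂ h₁ h₂ G hG
  obtain ⟨Ψ, hΨC, g0, g1, g2, g3⟩ := exists_psi F₁ F₂ h₁ h₂ G hG
  -- `w · w⁻¹ = 1` and its image under `Ψ`
  have hwinv := IsLocalization.Away.mul_invSelf (S := (Localization.Away (Ideal.Quotient.mk (Ideal.span {G}) (X 3)))) (Ideal.Quotient.mk (Ideal.span {G}) (X 3))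
  have hinv0 : IsLocalization.Away.invSelf (S := (Localization.Away (Ideal.Quotient.mk (Ideal.span {G}) (X 3)))) (Ideal.Quotient.mk (Ideal.span {G}) (X 3)) ≠ 0 := fun h => by
    rw [h, mul_zero] at hwinv
    exact zero_ne_one hwinv
  have hΨinv : algebraMap (MvPolynomial (Fin 5) k ⧸ Ideal.span {F₁, F₂}) (Localization.Away (Ideal.Quotient.mk (Ideal.span {F₁, F₂}) (X 2))) (Ideal.Quotient.mk _ (X 2)) *
      Ψ (IsLocalization.Away.invSelf (S := (Localization.Away (Ideal.Quotient.mk (Ideal.span {G}) (X 3)))) (Ideal.Quotient.mk (Ideal.span {G}) (X 3))) = 1 := by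
    have h := congrArg Ψ hwinv
    rwa [map_mul, map_one, g3] at h
  -- `Ψ ∘ Φ` is the localisation map, pointwise on `k[x,y,w,Z,U]`
  have hXcase : ∀ i : Fin 5, Ψ (Φ (Ideal.Quotient.mk _ (X i))) = algebraMap (MvPolynomial (Fin 5) k ⧸ Ideal.span {F₁, F₂}) (Localization.Away (Ideal.Quotient.mk (Ideal.span {F₁, F₂}) (X 2))) (Ideal.Quotient.mk _ (X i)) := by
    intro i
    rcases (by decide : ∀ i : Fin 5, i = 0 ∨ i = 1 ∨ i = 2 ∨ i = 3 ∨ i = 4) i with rfl | rfl | rfl | rfl | rfl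
    · rw [h0, g1]
    · rw [h1, g2]
    · rw [h2, g3]
    · rw [h3, map_mul, g0, mul_assoc, hΨinv, mul_one]
    · rw [h4, map_mul]
      simp only [map_add, map_pow, g1, g2]
      have htB : Ideal.Quotient.mk (Ideal.span {F₁, F₂}) (X 0) ^ 2 + Ideal.Quotient.mk (Ideal.span {F₁, F₂}) (X 1) ^ 3 =
          Ideal.Quotient.mk (Ideal.span {F₁, F₂}) (X 4) * Ideal.Quotient.mk (Ideal.span {F₁, F₂}) (X 2) := by
        rw [← map_pow, ← map_pow, ← map_add, ← map_mul, Ideal.Quotient.eq]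
        exact Ideal.mem_span_pair.mpr ⟨1, 0, by rw [h₁]; ring⟩
      have ht := congrArg (algebraMap (MvPolynomial (Fin 5) k ⧸ Ideal.span {F₁, F₂})
        (Localization.Away (Ideal.Quotient.mk (Ideal.span {F₁, F₂}) (X 2)))) htB
      simp only [map_add, map_pow, map_mul] at ht
      rw [ht, mul_assoc, hΨinv, mul_one]
  have hext : ∀ q : MvPolynomial (Fin 5) k,
      Ψ (Φ (Ideal.Quotient.mk _ q)) = algebraMap (MvPolynomial (Fin 5) k ⧸ Ideal.span {F₁, F₂}) (Localization.Away (Ideal.Quotient.mk (Ideal.span {F₁, F₂}) (X 2))) (Ideal.Quotient.mk _ q) := by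
    intro q
    induction q using MvPolynomial.induction_on with
    | C r =>
      have hC : Ideal.Quotient.mk (Ideal.span {F₁, F₂}) (C r) = algebraMap k (MvPolynomial (Fin 5) k ⧸ Ideal.span {F₁, F₂}) r := by
        rw [← MvPolynomial.algebraMap_eq]
        exact Ideal.Quotient.mk_algebraMap _ _ r
      rw [hC, AlgHom.commutes, hΨC, ← IsScalarTower.algebraMap_apply]
    | add p q hp hq => simp only [map_add, hp, hq]
    | mul_X p i hp => simp only [map_mul, hp, hXcase]
  -- injectivity
  have hinjB : Function.Injective (algebraMap (MvPolynomial (Fin 5) k ⧸ Ideal.span {F₁, F₂}) (Localization.Away (Ideal.Quotient.mk (Ideal.span {F₁, F₂}) (X 2)))) :=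
    IsLocalization.injective (M := Submonoid.powers (Ideal.Quotient.mk (Ideal.span {F₁, F₂}) (X 2))) (Localization.Away (Ideal.Quotient.mk (Ideal.span {F₁, F₂}) (X 2)))
      (Submonoid.powers_le.mpr hnzd)
  have hinj : Function.Injective Φ := by
    intro b₁ b₂ hb
    obtain ⟨q₁, rfl⟩ := Ideal.Quotient.mk_surjective b₁
    obtain ⟨q₂, rfl⟩ := Ideal.Quotient.mk_surjective b₂
    apply hinjB
    rw [← hext, ← hext, hb]
  exact ⟨Φ, hinj, hinv0, h0, h1, h2, h3, h4⟩

/-! ## (3) Primality and the non-vanishing of the variables -/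

/-- **THE P-CONE IDEAL `(x²+y³−wU, Z²+wU³+w³)` IS PRIME** in `k[x,y,w,Z,U]`, for every field `k`: `S/(F₁,F₂)` embeds into the
domain `A[1/w̄]` (`exists_wChart`). [folklore] -/
theorem pCone_isPrime (F₁ F₂ : MvPolynomial (Fin 5) k) (h₁ : F₁ = X 0 ^ 2 + X 1 ^ 3 - X 2 * X 4)
    (h₂ : F₂ = X 3 ^ 2 + X 2 * X 4 ^ 3 + X 2 ^ 3) : (Ideal.span {F₁, F₂}).IsPrime := by
  obtain ⟨Φ, hinj, -⟩ := exists_wChart F₁ F₂ h₁ h₂ (X 0 ^ 2 + X 3 ^ 5 + (X 1 ^ 2 + X 2 ^ 3) ^ 3 : MvPolynomial (Fin 4) k) rfl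
  haveI : IsDomain (Localization.Away (Ideal.Quotient.mk (Ideal.span
      {(X 0 ^ 2 + X 3 ^ 5 + (X 1 ^ 2 + X 2 ^ 3) ^ 3 : MvPolynomial (Fin 4) k)}) (X 3 : MvPolynomial (Fin 4) k))) :=
    PConePrimeCarrier.isDomain_away (X 0 ^ 2 + X 3 ^ 5 + (X 1 ^ 2 + X 2 ^ 3) ^ 3 : MvPolynomial (Fin 4) k) rfl
  have hdom : IsDomain (MvPolynomial (Fin 5) k ⧸ Ideal.span {F₁, F₂}) := Function.Injective.isDomain Φ.toRingHom hinj
  exact (Ideal.Quotient.isDomain_iff_prime (Ideal.span {F₁, F₂})).mp hdom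

/-- **The variables are non-zero modulo `(F₁,F₂)`**: `x̄, ȳ, w̄, Z̄, Ū ≠ 0` in `k[x,y,w,Z,U]/(F₁,F₂)` (their images under the
embedding `Φ` are the non-zero elements `x̄, ȳ, w̄, Ȳ/w̄, (x̄²+ȳ³)/w̄` of the domain `A[1/w̄]`). [folklore] -/
theorem pCone_X_ne_zero (F₁ F₂ : MvPolynomial (Fin 5) k) (h₁ : F₁ = X 0 ^ 2 + X 1 ^ 3 - X 2 * X 4)
    (h₂ : F₂ = X 3 ^ 2 + X 2 * X 4 ^ 3 + X 2 ^ 3) (v : Fin 5) :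
    Ideal.Quotient.mk (Ideal.span {F₁, F₂}) (X v) ≠ 0 := by
  obtain ⟨Φ, -, hinv, h0, h1, h2, h3, h4⟩ :=
    exists_wChart F₁ F₂ h₁ h₂ (X 0 ^ 2 + X 3 ^ 5 + (X 1 ^ 2 + X 2 ^ 3) ^ 3 : MvPolynomial (Fin 4) k) rfl
  have hinjA := PConePrimeCarrier.algebraMap_away_injective (X 0 ^ 2 + X 3 ^ 5 + (X 1 ^ 2 + X 2 ^ 3) ^ 3 : MvPolynomial (Fin 4) k) rfl
  haveI : IsDomain (Localization.Away (Ideal.Quotient.mk (Ideal.span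
      {(X 0 ^ 2 + X 3 ^ 5 + (X 1 ^ 2 + X 2 ^ 3) ^ 3 : MvPolynomial (Fin 4) k)}) (X 3 : MvPolynomial (Fin 4) k))) :=
    PConePrimeCarrier.isDomain_away (X 0 ^ 2 + X 3 ^ 5 + (X 1 ^ 2 + X 2 ^ 3) ^ 3 : MvPolynomial (Fin 4) k) rfl
  intro hv
  have hΦv := congrArg Φ hv
  rw [map_zero] at hΦv
  rcases (by decide : ∀ v : Fin 5, v = 0 ∨ v = 1 ∨ v = 2 ∨ v = 3 ∨ v = 4) v with rfl | rfl | rfl | rfl | rfl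
  · rw [h0] at hΦv
    exact PConePrimeCarrier.mk_X_succ_ne_zero _ rfl 0 ((injective_iff_map_eq_zero _).mp hinjA _ hΦv)
  · rw [h1] at hΦv
    exact PConePrimeCarrier.mk_X_succ_ne_zero _ rfl 1 ((injective_iff_map_eq_zero _).mp hinjA _ hΦv)
  · rw [h2] at hΦv
    exact PConePrimeCarrier.mk_X_succ_ne_zero _ rfl 2 ((injective_iff_map_eq_zero _).mp hinjA _ hΦv)
  · rw [h3] at hΦv
    rcases mul_eq_zero.mp hΦv with h | h
    · exact PConePrimeCarrier.mk_Y_ne_zero _ rfl ((injective_iff_map_eq_zero _).mp hinjA _ h)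
    · exact hinv h
  · rw [h4] at hΦv
    rcases mul_eq_zero.mp hΦv with h | h
    · exact PConePrimeCarrier.mk_t_ne_zero _ rfl ((injective_iff_map_eq_zero _).mp hinjA _ h)
    · exact hinv h

end Summit.ResolutionOfSingularities.ResolutionOfSingularities.Theorems.FInjectiveMacaulayfication.PConePrime

end
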